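import Summits.HodgeConjecture.HodgeConjecture.Theorems.F0P6aDatumOfInputsDefs
import Summits.HodgeConjecture.HodgeConjecture.Theorems.F0P6cHeckeBacktrack
import Literature.AlgebraicGeometry.AbelianSchemes.RoofDegreeIdentity
import Literature.AlgebraicGeometry.AbelianSchemes.IdealTorsionPointCountAlgClosedField
import Literature.AlgebraicGeometry.AbelianSchemes.PoincareSheafMulN
import Literature.AlgebraicGeometry.AbelianSchemes.RoofKernelIdealTorsion
import Literature.AlgebraicGeometry.AbelianSchemes.DualIsogenyKernel
import Literature.FieldTheory.AlgClosed.PadicAlgClosureEmbedsComplex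
import Literature.AlgebraicGeometry.AbelianSchemes.IdealTorsionPointsCoprimeSplitting
import HarnessLib
import HarnessLib.Audit.LibrarySuggestionsDenyListCruxes

/-!
# `F0P6aRoofKernelCountRoofKernelCount` — ★ RE-HOME of the crux workfile `Lines/F0_P6a_RoofKernelCount.lean` (tree sha16 d2af81f90ec7d7e6, 396 l., 19 declaration commands, code-`sorry`-free), PART 1 of 2

This `Theorems/` module is the TREE BYTES of that workfile with the NAMESPACE KEPT, so every fully-qualified name is UNCHANGED; only this module docstring is re-headed,
the `Lines` imports are switched to their ★ re-homed twins — `Lines.F0_P6a_DatumOfInputs` → ★ `Theorems.F0P6aDatumOfInputsDefs`; `Lines.F0_P6c_HeckeBacktrack` → ★ `Theorems.F0P6cHeckeBacktrack` — and the audit carrier `LibrarySuggestionsDenyListCruxes` is CARRIED on this root part (bare import, LEAD «M-142d» (1) rule «P-κ»; parts 2…n inherit it transitively)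
Why a re-home: a `Theorems/` file cannot import a `Lines/` workfile (F0P6-ref1 o-6), and closing stmt-HodgeConjecture-24832 `--as proved --by <Theorems decl>` at rung 0 needs the
sorry-free `Lines` chain behind the gate (RE-HOME TABLE v1.7, LA7-plan (g7); PLAN «L3 cone RE-HOME» v1, LA3-plan (g5); LEAD F0P6-plan (g5) «M-140» (1)∕(4), 2026-09-02).
SIZE LINT (`Theorems/` files with proofs ≤ 400 l.): the workfile is cut into 2 consecutive parts `F0P6aRoofKernelCountRoofKernelCount` → `F0P6aRoofKernelCount`; this is PART 1 (tree lines :1–:336); each later part imports the previous one and re-opens the scopes open at its cut with their `variable`∕`open`∕`set_option` lines replayed verbatim; the LAST part `F0P6aRoofKernelCount` is the module the `Lines/` shim and consumers import.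
After the chain is ★ the `Lines` workfile becomes a one-import SHIM of `F0P6aRoofKernelCount` (a `Lines/` write, batched per cone on the LEAD՚s word), so no environment holds two copies (NO-CROSS-IMPORT).
It asserts nothing beyond what the workfile already proves.  HC_CM is proved only modulo the 7 printed citations (2 remaining: hLiu418 = stmt-HodgeConjecture-24832, h413 = stmt-HodgeConjecture-24833) until rung 0 closes; a re-home is count-neutral.

## Original module docstring (verbatim)
# L2 ORGAN (ρ2‴)-C — «`hdeg` DISCHARGED IN DATUM CURRENCY»: `#K = q²` for the kernel of every `RoofLink` roof (LA2-plan (g2) deal 07:16:10Z; payer LA2-p03 (g2);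
# HOME-first `F0/P6/L2/LA2-p03/g2/RoofKernelCount.datum.v1.LA2-p03g2.lean`; pastes into the LS leaflet ED. 4 as `section RoofKernelCount`; count-neutral, nothing registered)

For the moduli datum `I : RGDInputsAt …` and readings `quotΩ`, `translΩ` with the Hecke clause, the two roof links and the two K-tests (`hunit`, `hKc` — the
`_hhecke _hunit _hKc _hroof _hroof₂` prefix of `stub_ROOF0`∕`stub_SPGEOM`), EVERY kernel `K ≤ A_y(Ω̄)` served by `RoofLink I quotΩ` at `(y, L)` has
`Nat.card K = p ^ (2 f) = q²` — the DEGREE CLAUSE `hdeg` of ★ (ρ2″) `isIdealTorsion_mul_of_roof` and the rank row `hrk` of the block assembly.  The proof is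
one application of ★ (ρ2‴) `natCard_eq_of_three_roofs'` ([Liu2021] Prop. D.8 read through degrees: [MumfordAV1970] §15 Thm. 1, [GortzWedhorn2023] Prop. 27.213 (3)
via ★ (B2) `DualIsogenyDegreeEq`) to the three roofs `RoofLink (y, L)`, `RoofLink (quotΩ y L, L_b)` (with ★ HBT `quotΩ (quotΩ y L) L_b = translΩ y`) and
`RoofLink₂ y`, the counts `#A[𝔭_w](Ω̄) = #A[𝔭_{c•w}](Ω̄) = q²` at the generic fibres being ★ (LAT-C) ([Shimura1998] §7.5) with `I.hg`, `I.relDim`, `I.hfDeg`.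
HC_CM is proved only modulo the 7 printed citations (2 remaining: hLiu418 = stmt-HodgeConjecture-24832, h413 = stmt-HodgeConjecture-24833) until rung 0 closes.

* `actΩROf I y` (abbrev): the `𝒪_F`-action on the generic fibre `A_y` as a ★ `RingAction` (`(actΩOf … I.act a y).hom.hom.hom = (actΩROf I y).i a`, `rfl`).
* `natCard_idealTorsionΩ_eq_of_absNorm_eq`, `natCard_idealTorsionΩ_w_eq`, `natCard_idealTorsionΩ_cw_eq` — `#A_y[𝔭](Ω̄) = p^{2f}` for `𝔭 = 𝔭_w, 𝔭_{c•w}`.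
* `polQuasiInvΩ` — (P-1) at the fibre.  * `isOfRelDim_schΩOf` — `A_y` has relative dimension `g`.
* HEAD `natCard_roofKernel_eq` and the corollary `natCard_roofKernel_eq_natCard_idealTorsionΩ` (★ (ρ2″)'s `hdeg` text).
* (v2, organ (ρ2″)-C) `not_sq_conj_dvd_span_of_not_sq_dvd_span` (`hunr ⇒ hunr′`: `c` fixes `(p)`), `rosatiΩ` (`I.rosati` at the fibre, ★ `pullback_map_dualIsogenyOver` ×2),
  HEAD **`isIdealTorsionΩ_mul_of_roofLink`** — `K ⊆ A_y[𝔭_w𝔭_{c•w}]` for every `RoofLink` kernel (★ (ρ2″) `isIdealTorsion_mul_of_roof` with ALL its binders discharged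
  from the datum; `hunr` explicit, = spine ED. 5 `I.hunr` body) and **`mem_line_of_forall_pow_of_roofLink`** (`K[𝔭_{c•w}^∞] = L`, ★ ED. 2 `mem_of_forall_mem_pow_of_roof`).
* (v3, organ (ρ2‴)-D) `roofKernel_stable` (`K` is `ι`-stable, ★ ED. 3 `map_i_mem_of_roof`) and HEAD **`natCard_roofKernel_inf_idealTorsionΩ_w_eq`** — the `w`-part
  `K ∩ A_y[𝔭_w](Ω̄)` has `q = p^f` points (★ `IdealTorsionPointsCoprimeSplitting`: `#K = #K[𝔭_w]·#K[𝔭_{c•w}]`, `#K = q²`, `K[𝔭_{c•w}] = L` of order `q`).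
-/

set_option autoImplicit false
set_option linter.dupNamespace false

noncomputable section

namespace Summit.HodgeConjecture.HodgeConjecture.Cruxes.HLiu418.F0P6aLineSpecialisation

open CategoryTheory CategoryTheory.Limits NumberField IsDedekindDomain MulAction AlgebraicGeometry
open scoped Matrix Pointwise MonObj
open Literature.NumberTheory.GaloisRepresentations
open Literature.NumberTheory.Automorphic Literature.NumberTheory.Automorphic.UnitaryGroup
open Literature.AlgebraicGeometry.ShimuraVarieties.UnitaryCanonicalModel
open Literature.NumberTheory.Automorphic.Liu2021.AppendixC
open Literature.AlgebraicGeometry.Motives (AlgPoints IntegralModel SchemeOver thickening thickeningLift specOver)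
open Literature.NumberTheory.DiophantineGeometry (geomResidueField)
open Literature.AlgebraicGeometry.RelativeSpec (ActionOver)
open Literature.NumberTheory.EllipticCurves (specGenericPoint)
open Literature.AlgebraicGeometry.AbelianSchemes Literature.AlgebraicGeometry.AbelianSchemes.AbelianSchemeOver
open Summit.HodgeConjecture.HodgeConjecture.Cruxes.HLiu418.F0P6aModuliDatumDefs
open Summit.HodgeConjecture.HodgeConjecture.Cruxes.HLiu418.F0P6aRGDAssembly
open Summit.HodgeConjecture.HodgeConjecture.Cruxes.HLiu418.F0P6aDatumOfInputs
open Summit.HodgeConjecture.HodgeConjecture.Cruxes.HLiu418.F0P6cHeckeBacktrack (exists_line_quotΩ_quotΩ_eq_translΩ_of_hecke_of_hyperspecial)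

section RoofKernelCount

-- the D-line `Letters` frame VERBATIM (upstairs only: no `[IsGalois ℚ F]`, no `[ExpChar …]`)
variable {F : Type} [Field F] [NumberField F] [IsCMField F] {ι₁ : F →+* ℂ}
    {Jstar : Matrix (Fin 2) (Fin 2) F}
    {K₀ : C5.OpenCompactSubgroup ↥(finAdelic ↥(maximalRealSubfield F) F (IsCMField.complexConj F) 2 Jstar)}
    {S : RecordSystemGS F Jstar ι₁ K₀} {hU7ₛ : S.HeckeTranslateDefinedOver}
    {hJ : (Jstar.map (IsCMField.complexConj F))ᵀ = Jstar} {hJu : IsUnit Jstar}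
    {Fi : Type} [Field Fi] [Algebra F Fi] {Kc : C5.SmallLevel K₀} {G : Type} [Group G]
    {𝓜 : IntegralModel (𝓞 F) F ((thickening F Fi).obj (S.M.obj Kc))}
    {w : HeightOneSpectrum (𝓞 F)} {hw : (IsCMField.complexConj F) • w ≠ w} {h𝓨 : (𝓜.localise w).IsSmoothProper 1}
    {θ : ActionOver (𝓜.localise w).total.hom ((Fi ≃ₐ[F] Fi) × G)}
    {e : Fi →ₐ[F] AlgebraicClosure (w.adicCompletion F)}

/-- The structure morphism of the generic fibre of `𝓨`, `𝓨_η → 𝓨` (the first base change in ★ `fibreΩOf`∕`schΩOf`∕`actΩOf`). An abbreviation. -/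
abbrev genΩ (𝓜 : IntegralModel (𝓞 F) F ((thickening F Fi).obj (S.M.obj Kc))) (w : HeightOneSpectrum (𝓞 F)) :=
  (𝓜.localise w).genericIso'.inv.left ≫
    pullback.fst (𝓜.localise w).total.hom (specGenericPoint (HeightOneSpectrum.valuationSubringAtPrime F w) F)

/-- **The `𝒪_F`-action on the generic fibre `A_y` as a ★ `RingAction`** (`I.act` base-changed twice, exactly as `schΩOf` base-changes `I.univ`):
`(actΩOf … I.act a y).hom.hom.hom = (actΩROf I y).i a` definitionally. [cite: Kottwitz1992, §5, p. 390] -/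
abbrev actΩROf (I : RGDInputsAt F ι₁ Jstar K₀ S hU7ₛ hJ hJu Fi Kc G 𝓜 w hw h𝓨 θ e)
    (y : AlgPoints (S.M.obj Kc) (AlgebraicClosure (w.adicCompletion F))) : (schΩOf S Kc 𝓜 w e I.univ y).RingAction (𝓞 F) :=
  (I.act.baseChange (genΩ 𝓜 w)).baseChange (thickeningLift e (S.M.obj Kc) y).left

/-- `ι(a)_y` read through `actΩROf`: `(actΩOf … I.act a y).hom.hom.hom = (actΩROf I y).i a` (`rfl`). [cite: Kottwitz1992, §5, p. 390] -/
theorem actΩOf_hom_eq (I : RGDInputsAt F ι₁ Jstar K₀ S hU7ₛ hJ hJu Fi Kc G 𝓜 w hw h𝓨 θ e)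
    (y : AlgPoints (S.M.obj Kc) (AlgebraicClosure (w.adicCompletion F))) (a : 𝓞 F) :
    (actΩOf S Kc 𝓜 w e I.univ I.act a y).hom.hom.hom = (actΩROf I y).i a := rfl

/-- `IsIdealTorsionΩ` read through `actΩROf` (`Iff.rfl`). [cite: Shimura1998, §7.5 p. 72] -/
theorem isIdealTorsionΩ_iff (I : RGDInputsAt F ι₁ Jstar K₀ S hU7ₛ hJ hJu Fi Kc G 𝓜 w hw h𝓨 θ e)
    (y : AlgPoints (S.M.obj Kc) (AlgebraicClosure (w.adicCompletion F))) (𝔞 : Ideal (𝓞 F))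
    (P : (fibreΩOf S Kc 𝓜 w e I.univ y).Points (AlgebraicClosure (w.adicCompletion F))) :
    IsIdealTorsionΩ S Kc 𝓜 w e I.univ I.act y 𝔞 P ↔ ∀ a ∈ 𝔞, P ≫ (actΩROf I y).i a = 1 :=
  Iff.rfl

/-- **`A_y` has relative dimension `g`** (`I.relDim` base-changed twice, ★ `IsOfRelDim.baseChange`). [cite: MumfordFogartyKirwan1994, Ch. 6 §1 (p. 115)] -/
theorem isOfRelDim_schΩOf (I : RGDInputsAt F ι₁ Jstar K₀ S hU7ₛ hJ hJu Fi Kc G 𝓜 w hw h𝓨 θ e)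
    (y : AlgPoints (S.M.obj Kc) (AlgebraicClosure (w.adicCompletion F))) : (schΩOf S Kc 𝓜 w e I.univ y).IsOfRelDim I.g :=
  (I.relDim.baseChange (genΩ 𝓜 w)).baseChange (thickeningLift e (S.M.obj Kc) y).left

/-- **(P-1) AT THE FIBRE**: `λ_y ≫ ν_y = [d]` with `p ∤ d` (`I.polQuasiInv` base-changed twice; ★ `baseChangeHom_mulN`).
[cite: MumfordFogartyKirwan1994, Ch. 6 §2 Definition 6.3 (p. 120)] -/
theorem polQuasiInvΩ (I : RGDInputsAt F ι₁ Jstar K₀ S hU7ₛ hJ hJu Fi Kc G 𝓜 w hw h𝓨 θ e)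
    (y : AlgPoints (S.M.obj Kc) (AlgebraicClosure (w.adicCompletion F))) :
    ∃ (d : ℕ) (ν : (dualΩOf S Kc 𝓜 w e I.univ I.dual y).hat.X ⟶ (schΩOf S Kc 𝓜 w e I.univ y).X), IsMonHom ν ∧ I.pChar.Coprime d ∧
      (polΩOf S Kc 𝓜 w e I.univ I.pol y).lam ≫ ν = (schΩOf S Kc 𝓜 w e I.univ y).mulN d := by
  obtain ⟨d, ν, hν, hcop, h⟩ := I.polQuasiInv
  haveI := hν
  haveI h2 := isMonHom_pullback_map (genΩ 𝓜 w) ν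
  haveI h3 := isMonHom_pullback_map (A := I.dual.hat.baseChange (genΩ 𝓜 w)) (B := I.univ.baseChange (genΩ 𝓜 w))
    (thickeningLift e (S.M.obj Kc) y).left ((Over.pullback (genΩ 𝓜 w)).map ν)
  refine ⟨d, (Over.pullback (thickeningLift e (S.M.obj Kc) y).left).map ((Over.pullback (genΩ 𝓜 w)).map ν), h3, hcop, ?_⟩
  have h1 : (Over.pullback (genΩ 𝓜 w)).map I.pol.lam ≫ (Over.pullback (genΩ 𝓜 w)).map ν = (I.univ.baseChange (genΩ 𝓜 w)).mulN d := by
    rw [← Functor.map_comp, h]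
    exact I.univ.baseChangeHom_mulN (genΩ 𝓜 w) d
  have h4 : (Over.pullback (thickeningLift e (S.M.obj Kc) y).left).map ((Over.pullback (genΩ 𝓜 w)).map I.pol.lam) ≫
      (Over.pullback (thickeningLift e (S.M.obj Kc) y).left).map ((Over.pullback (genΩ 𝓜 w)).map ν) =
      ((I.univ.baseChange (genΩ 𝓜 w)).baseChange (thickeningLift e (S.M.obj Kc) y).left).mulN d := by
    rw [← Functor.map_comp, h1]
    exact (I.univ.baseChange (genΩ 𝓜 w)).baseChangeHom_mulN (thickeningLift e (S.M.obj Kc) y).left d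
  exact h4

/-- **`#A_y[𝔞](Ω̄) = p^{2f}` for an ideal of norm `p^f`** (★ (LAT-C) at the generic fibre: exponent `2g ∕ rk_ℤ 𝒪_F = 2` by `I.hg`). [cite: Shimura1998, §7.5 p. 72] -/
theorem natCard_idealTorsionΩ_eq_of_absNorm_eq (I : RGDInputsAt F ι₁ Jstar K₀ S hU7ₛ hJ hJu Fi Kc G 𝓜 w hw h𝓨 θ e)
    (y : AlgPoints (S.M.obj Kc) (AlgebraicClosure (w.adicCompletion F))) (𝔞 : Ideal (𝓞 F)) (h𝔞 : 𝔞 ≠ ⊥)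
    (hN : Ideal.absNorm 𝔞 = I.pChar ^ I.fDeg) :
    Nat.card {P : (fibreΩOf S Kc 𝓜 w e I.univ y).Points (AlgebraicClosure (w.adicCompletion F)) // IsIdealTorsionΩ S Kc 𝓜 w e I.univ I.act y 𝔞 P} =
      I.pChar ^ (2 * I.fDeg) := by
  have h := natCard_idealTorsion_algPoints_baseChange_eq_absNorm_pow_adicCompletion F w (I.act.baseChange (genΩ 𝓜 w))
    (I.relDim.baseChange (genΩ 𝓜 w)) (thickeningLift e (S.M.obj Kc) y).left 𝔞 h𝔞
  have hexp : 2 * I.g / Module.finrank ℤ (𝓞 F) = 2 := by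
    rw [RingOfIntegers.rank, I.hg]
    exact Nat.mul_div_cancel 2 Module.finrank_pos
  rw [hexp, hN, ← pow_mul, mul_comm] at h
  exact h

/-- `N(𝔭_{c•w}) = p^f` (`I.hfDeg`, `Ideal.absNorm = #quotient`). [cite: Neukirch1999, Ch. I §3 (3.8)–(3.9)] -/
theorem absNorm_cw_eq (I : RGDInputsAt F ι₁ Jstar K₀ S hU7ₛ hJ hJu Fi Kc G 𝓜 w hw h𝓨 θ e) :
    Ideal.absNorm (((IsCMField.complexConj F) • w).asIdeal) = I.pChar ^ I.fDeg := by
  rw [Ideal.absNorm_apply, Submodule.cardQuot_apply]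
  exact I.hfDeg

/-- `N(𝔭_w) = p^f`: Galois-conjugate ideals have the same norm (`𝔭_{c•w} = c • 𝔭_w`, the quotient rings are isomorphic along `c`). [cite: Neukirch1999, Ch. I §9] -/
theorem absNorm_w_eq (I : RGDInputsAt F ι₁ Jstar K₀ S hU7ₛ hJ hJu Fi Kc G 𝓜 w hw h𝓨 θ e) :
    Ideal.absNorm w.asIdeal = I.pChar ^ I.fDeg := by
  rw [← absNorm_cw_eq I]
  have hq : ((IsCMField.complexConj F) • w).asIdeal = (IsCMField.complexConj F) • w.asIdeal := rfl
  let f : 𝓞 F ≃+* 𝓞 F := MulSemiringAction.toRingEquiv _ (𝓞 F) (IsCMField.complexConj F)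
  have hf : (IsCMField.complexConj F) • w.asIdeal = w.asIdeal.map (f : 𝓞 F →+* 𝓞 F) := by rw [Ideal.pointwise_smul_def]; rfl
  rw [hq, Ideal.absNorm_apply, Ideal.absNorm_apply, Submodule.cardQuot_apply, Submodule.cardQuot_apply]
  exact Nat.card_congr (Ideal.quotientEquiv w.asIdeal _ f hf).toEquiv

/-- **`#A_y[𝔭_w](Ω̄) = p^{2f}`.** [cite: Shimura1998, §7.5 p. 72] -/
theorem natCard_idealTorsionΩ_w_eq (I : RGDInputsAt F ι₁ Jstar K₀ S hU7ₛ hJ hJu Fi Kc G 𝓜 w hw h𝓨 θ e)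
    (y : AlgPoints (S.M.obj Kc) (AlgebraicClosure (w.adicCompletion F))) :
    Nat.card {P : (fibreΩOf S Kc 𝓜 w e I.univ y).Points (AlgebraicClosure (w.adicCompletion F)) //
        IsIdealTorsionΩ S Kc 𝓜 w e I.univ I.act y w.asIdeal P} = I.pChar ^ (2 * I.fDeg) :=
  natCard_idealTorsionΩ_eq_of_absNorm_eq I y w.asIdeal w.ne_bot (absNorm_w_eq I)

/-- **`#A_y[𝔭_{c•w}](Ω̄) = p^{2f}`.** [cite: Shimura1998, §7.5 p. 72] -/
theorem natCard_idealTorsionΩ_cw_eq (I : RGDInputsAt F ι₁ Jstar K₀ S hU7ₛ hJ hJu Fi Kc G 𝓜 w hw h𝓨 θ e)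
    (y : AlgPoints (S.M.obj Kc) (AlgebraicClosure (w.adicCompletion F))) :
    Nat.card {P : (fibreΩOf S Kc 𝓜 w e I.univ y).Points (AlgebraicClosure (w.adicCompletion F)) //
        IsIdealTorsionΩ S Kc 𝓜 w e I.univ I.act y ((IsCMField.complexConj F) • w).asIdeal P} = I.pChar ^ (2 * I.fDeg) :=
  natCard_idealTorsionΩ_eq_of_absNorm_eq I y _ ((IsCMField.complexConj F) • w).ne_bot (absNorm_cw_eq I)

set_option maxHeartbeats 400000 in
/-- **THE ROOF KERNEL HAS `q²` POINTS** — `hdeg`∕`hrk` in datum currency: for every `y`, every line `L : LineOf I y` and every kernel `K` served by `RoofLink I quotΩ` at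
`(y, L)` (its two clauses `hK` VERBATIM), `Nat.card K = p ^ (2 f)`.  Three roofs — `RoofLink (y, L)`, `RoofLink (quotΩ y L, L_b)` for the HBT backtracking line `L_b`
(★ `exists_line_quotΩ_quotΩ_eq_translΩ_of_hecke_of_hyperspecial`: `quotΩ (quotΩ y L) L_b = translΩ y`, from `hhecke hunit hKc`), `RoofLink₂ y` — fed to ★ (ρ2‴)
`natCard_eq_of_three_roofs'` with the ★ (LAT-C) counts `#A[𝔭_w] = #A[𝔭_{c•w}] = p^{2f}` and (P-1) at the three fibres.
[cite: Liu2021, Prop. D.8 (pp. 135–138)] [cite: MumfordAV1970, §15 Thm. 1 (p. 143); §23 Thm. 2 (p. 231)] [cite: GortzWedhorn2023, Prop. 27.213 (3)] -/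
theorem natCard_roofKernel_eq (I : RGDInputsAt F ι₁ Jstar K₀ S hU7ₛ hJ hJu Fi Kc G 𝓜 w hw h𝓨 θ e)
    (quotΩ : ∀ y, LineOf I y → AlgPoints (S.M.obj Kc) (AlgebraicClosure (w.adicCompletion F)))
    (translΩ : AlgPoints (S.M.obj Kc) (AlgebraicClosure (w.adicCompletion F)) → AlgPoints (S.M.obj Kc) (AlgebraicClosure (w.adicCompletion F)))
    (hhecke : HeckeClause I quotΩ translΩ)
    (hunit : (UnitaryGroup.isUnit_placeForm Jstar hJu w).unit ∈ glInt 2 (w.adicCompletion F))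
    (hKc : UnitaryGroup.IsHyperspecialAt ↥(maximalRealSubfield F) F (IsCMField.complexConj F) 2 Jstar Kc.1.1
      (w.under (𝓞 ↥(maximalRealSubfield F))))
    (hroof : RoofLink I quotΩ) (hroof₂ : RoofLink₂ I translΩ)
    (y : AlgPoints (S.M.obj Kc) (AlgebraicClosure (w.adicCompletion F))) (L : LineOf I y)
    (K : Subgroup ((fibreΩOf S Kc 𝓜 w e I.univ y).Points (AlgebraicClosure (w.adicCompletion F))))
    (hK : (∀ P, P ∈ L.1 ↔ P ∈ K ∧ IsIdealTorsionΩ S Kc 𝓜 w e I.univ I.act y ((IsCMField.complexConj F) • w).asIdeal P) ∧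
      RoofΩ S Kc 𝓜 w e I.univ I.act I.dual I.pol I.lvl I.pChar w.asIdeal y (quotΩ y L) K) :
    Nat.card ↥K = I.pChar ^ (2 * I.fDeg) := by
  -- the backtracking line and the three roofs
  obtain ⟨L_b, hLb⟩ := exists_line_quotΩ_quotΩ_eq_translΩ_of_hecke_of_hyperspecial F ι₁ Jstar K₀ S hU7ₛ hJ hJu w hw Kc (LineOf I)
    quotΩ translΩ hhecke hunit hKc y L
  have hroof' := hroof (quotΩ y L) L_b
  rw [hLb] at hroof'
  obtain ⟨K'', -, hR₂⟩ := hroof'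
  obtain ⟨K₂, hK₂, hR₃⟩ := hroof₂ y
  obtain ⟨B₁, DB₁, lamB₁, hlamB₁, hDB₁, q₁, hq₁, c₁, hc₁, h1₁, h2₁, h2s₁, h3₁, h3₁'', -, -⟩ := hK.2
  obtain ⟨B₂, DB₂, lamB₂, hlamB₂, hDB₂, q₂, hq₂, c₂, hc₂, h1₂, h2₂, h2s₂, h3₂, h3₂'', -, -⟩ := hR₂
  obtain ⟨B₃, DB₃, lamB₃, hlamB₃, hDB₃, q₃, hq₃, c₃, hc₃, h1₃, h2₃, h2s₃, h3₃, h3₃'', -, -⟩ := hR₃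
  haveI := hlamB₁; haveI := hlamB₂; haveI := hlamB₃
  haveI := hq₁; haveI := hq₂; haveI := hq₃
  haveI := hc₁; haveI := hc₂; haveI := hc₃
  -- the counts
  have hK₂c : Nat.card ↥K₂ = I.pChar ^ (2 * I.fDeg) := by
    rw [← natCard_idealTorsionΩ_cw_eq I y]
    exact Nat.card_congr (Equiv.subtypeEquivRight fun P => hK₂ P)
  exact natCard_eq_of_three_roofs' (isOfRelDim_schΩOf I y) (isOfRelDim_schΩOf I (quotΩ y L)) (isOfRelDim_schΩOf I (translΩ y))
    (dualΩOf S Kc 𝓜 w e I.univ I.dual y) (polΩOf S Kc 𝓜 w e I.univ I.pol y)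
    (dualΩOf S Kc 𝓜 w e I.univ I.dual (quotΩ y L)) (polΩOf S Kc 𝓜 w e I.univ I.pol (quotΩ y L))
    (dualΩOf S Kc 𝓜 w e I.univ I.dual (translΩ y)) (polΩOf S Kc 𝓜 w e I.univ I.pol (translΩ y))
    I.hpChar.1 (k := 2 * I.fDeg) rfl (polQuasiInvΩ I y) (polQuasiInvΩ I (quotΩ y L)) (polQuasiInvΩ I (translΩ y))
    DB₁ lamB₁ hDB₁ q₁ c₁ K h1₁ _ h2₁ h2s₁ h3₁ h3₁'' (natCard_idealTorsionΩ_w_eq I (quotΩ y L))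
    DB₂ lamB₂ hDB₂ q₂ c₂ K'' h1₂ _ h2₂ h2s₂ h3₂ h3₂'' (natCard_idealTorsionΩ_w_eq I (translΩ y))
    DB₃ lamB₃ hDB₃ q₃ c₃ K₂ h1₃ _ h2₃ h2s₃ h3₃ h3₃'' (natCard_idealTorsionΩ_w_eq I (translΩ y)) hK₂c

set_option maxHeartbeats 400000 in
/-- **`hdeg` IN ★ (ρ2″)'s TEXT**: `Nat.card K = #A_{y″}[𝔭_w](Ω̄)` for `y″ = quotΩ y L` (both sides `= p^{2f}`).
[cite: Liu2021, Prop. D.8 (pp. 135–138)] [cite: Shimura1998, §7.5 p. 72] -/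
theorem natCard_roofKernel_eq_natCard_idealTorsionΩ (I : RGDInputsAt F ι₁ Jstar K₀ S hU7ₛ hJ hJu Fi Kc G 𝓜 w hw h𝓨 θ e)
    (quotΩ : ∀ y, LineOf I y → AlgPoints (S.M.obj Kc) (AlgebraicClosure (w.adicCompletion F)))
    (translΩ : AlgPoints (S.M.obj Kc) (AlgebraicClosure (w.adicCompletion F)) → AlgPoints (S.M.obj Kc) (AlgebraicClosure (w.adicCompletion F)))
    (hhecke : HeckeClause I quotΩ translΩ)
    (hunit : (UnitaryGroup.isUnit_placeForm Jstar hJu w).unit ∈ glInt 2 (w.adicCompletion F))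
    (hKc : UnitaryGroup.IsHyperspecialAt ↥(maximalRealSubfield F) F (IsCMField.complexConj F) 2 Jstar Kc.1.1
      (w.under (𝓞 ↥(maximalRealSubfield F))))
    (hroof : RoofLink I quotΩ) (hroof₂ : RoofLink₂ I translΩ)
    (y : AlgPoints (S.M.obj Kc) (AlgebraicClosure (w.adicCompletion F))) (L : LineOf I y)
    (K : Subgroup ((fibreΩOf S Kc 𝓜 w e I.univ y).Points (AlgebraicClosure (w.adicCompletion F))))
    (hK : (∀ P, P ∈ L.1 ↔ P ∈ K ∧ IsIdealTorsionΩ S Kc 𝓜 w e I.univ I.act y ((IsCMField.complexConj F) • w).asIdeal P) ∧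
      RoofΩ S Kc 𝓜 w e I.univ I.act I.dual I.pol I.lvl I.pChar w.asIdeal y (quotΩ y L) K) :
    Nat.card ↥K = Nat.card {P : (fibreΩOf S Kc 𝓜 w e I.univ (quotΩ y L)).Points (AlgebraicClosure (w.adicCompletion F)) //
        IsIdealTorsionΩ S Kc 𝓜 w e I.univ I.act (quotΩ y L) w.asIdeal P} := by
  rw [natCard_roofKernel_eq I quotΩ translΩ hhecke hunit hKc hroof hroof₂ y L K hK, natCard_idealTorsionΩ_w_eq I (quotΩ y L)]

/-! ### (v2) ORGAN (ρ2″)-C — `K ⊆ A_y[𝔭_w 𝔭_{c•w}]` in datum currency -/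

omit [IsCMField F] in
/-- **`hunr ⇒ hunr′`**: if `𝔭_w² ∤ (p)` then `𝔭_{c•w}² ∤ (p)` — `c` is a ring automorphism of `𝒪_F` fixing `(p)`, and `c • 𝔭_{c•w} = 𝔭_w`.
[cite: Neukirch1999, Ch. I §9] -/
theorem not_sq_conj_dvd_span_of_not_sq_dvd_span [IsCMField F] (w : HeightOneSpectrum (𝓞 F)) (p : ℕ)
    (hunr : ¬ (w.asIdeal ^ 2 ∣ Ideal.span {((p : ℕ) : 𝓞 F)})) :
    ¬ (((IsCMField.complexConj F) • w).asIdeal ^ 2 ∣ Ideal.span {((p : ℕ) : 𝓞 F)}) := by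
  intro h
  apply hunr
  set c := IsCMField.complexConj F with hc
  have hcc : c * c = 1 := by
    ext x
    rw [AlgEquiv.mul_apply, AlgEquiv.one_apply, hc, IsCMField.complexConj_apply_apply]
  have hq : (c • w).asIdeal = c • w.asIdeal := rfl
  have hsmul𝔭 : c • (c • w).asIdeal = w.asIdeal := by rw [hq, smul_smul, hcc, one_smul]
  have hspan : c • Ideal.span {((p : ℕ) : 𝓞 F)} = Ideal.span {((p : ℕ) : 𝓞 F)} := by
    rw [Ideal.pointwise_smul_def, Ideal.map_span, Set.image_singleton, map_natCast]
  obtain ⟨J, hJ⟩ := h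
  refine ⟨c • J, ?_⟩
  have e : c • Ideal.span {((p : ℕ) : 𝓞 F)} = c • ((c • w).asIdeal ^ 2 * J) := congrArg (fun I : Ideal (𝓞 F) => c • I) hJ
  rw [hspan] at e
  rw [e, Ideal.pointwise_smul_def, Ideal.map_mul, Ideal.map_pow, ← Ideal.pointwise_smul_def, ← Ideal.pointwise_smul_def, hsmul𝔭]

set_option maxHeartbeats 400000 in
/-- **ROSATI AT THE FIBRE**: `ι(b̄)_y ≫ λ_y = λ_y ≫ (ι(b)_y)^∨` (`I.rosati` base-changed twice; the dual homomorphism commutes with base change, ★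
`DualPair.pullback_map_dualIsogenyOver`). [cite: MumfordAV1970, §20–§21 (pp. 189–208); §15 Thm. 1 (p. 143)] [cite: MumfordFogartyKirwan1994, Ch. 6 §1 Cor. 6.8 (p. 118)] -/
theorem rosatiΩ (I : RGDInputsAt F ι₁ Jstar K₀ S hU7ₛ hJ hJu Fi Kc G 𝓜 w hw h𝓨 θ e)
    (y : AlgPoints (S.M.obj Kc) (AlgebraicClosure (w.adicCompletion F))) (b b' : 𝓞 F)
    (hbb' : (b' : F) = (IsCMField.complexConj F) (b : F)) :
    haveI := (actΩROf I y).isMonHom b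
    (actΩROf I y).i b' ≫ (polΩOf S Kc 𝓜 w e I.univ I.pol y).lam =
      (polΩOf S Kc 𝓜 w e I.univ I.pol y).lam ≫
        DualPair.dualIsogenyOver ((actΩROf I y).i b) (dualΩOf S Kc 𝓜 w e I.univ I.dual y) (dualΩOf S Kc 𝓜 w e I.univ I.dual y) := by
  haveI := I.act.isMonHom b
  haveI := I.act.isMonHom b'
  have h := I.rosati b b' hbb'
  have h1 := congrArg (fun φ => (Over.pullback (genΩ 𝓜 w)).map φ) h
  simp only [Functor.map_comp] at h1
  rw [DualPair.pullback_map_dualIsogenyOver] at h1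
  haveI := isMonHom_baseChangeHom (I.act.i b) (genΩ 𝓜 w)
  have h2 := congrArg (fun φ => (Over.pullback (thickeningLift e (S.M.obj Kc) y).left).map φ) h1
  simp only [Functor.map_comp] at h2
  have e2 := DualPair.pullback_map_dualIsogenyOver (baseChangeHom (I.act.i b) (genΩ 𝓜 w)) (I.dual.baseChange (genΩ 𝓜 w))
    (I.dual.baseChange (genΩ 𝓜 w)) (thickeningLift e (S.M.obj Kc) y).left
  exact h2.trans (congrArg (fun X => (Over.pullback (thickeningLift e (S.M.obj Kc) y).left).map
    ((Over.pullback (genΩ 𝓜 w)).map I.pol.lam) ≫ X) e2)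

set_option maxHeartbeats 400000 in
/-- **THE ROOF KERNEL IS `𝔭_w𝔭_{c•w}`-TORSION — (r0) in datum currency**: for every `y`, `L : LineOf I y` and kernel `K` served by `RoofLink I quotΩ` at `(y, L)`,
every `P ∈ K` is killed by `ι(𝔭_w𝔭_{c•w})`.  ★ (ρ2″) `isIdealTorsion_mul_of_roof` at `A := A_y`, `A″ := A_{y″}` (`y″ = quotΩ y L`), `act := actΩROf I ·`, with its binders
discharged: `hp hpw ← I.hpChar`, `hunr′ ←` `not_sq_conj_dvd_span_of_not_sq_dvd_span hunr`, `σ : Ω̄ →+* ℂ` ★, `hA″ ← isOfRelDim_schΩOf + I.hg`, (r1)–(r4) ← `RoofΩ`, `hros″ ← rosatiΩ`,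
`hν ← polQuasiInvΩ`, `hdeg ← natCard_roofKernel_eq_natCard_idealTorsionΩ` ((ρ2‴)-C); `hunr` stays an explicit binder (spine ED. 5 `I.hunr` body, token for token).
[cite: Liu2021, Prop. D.8 (pp. 135–138)] [cite: MumfordAV1970, §7 Thm. 4 (p. 72); §15 Thm. 1 (p. 143); §23 Thm. 2 (p. 231)] [cite: Shimura1998, §13.1 Thm. 1 (pp. 97–99)] -/
theorem isIdealTorsionΩ_mul_of_roofLink (I : RGDInputsAt F ι₁ Jstar K₀ S hU7ₛ hJ hJu Fi Kc G 𝓜 w hw h𝓨 θ e)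
    (quotΩ : ∀ y, LineOf I y → AlgPoints (S.M.obj Kc) (AlgebraicClosure (w.adicCompletion F)))
    (translΩ : AlgPoints (S.M.obj Kc) (AlgebraicClosure (w.adicCompletion F)) → AlgPoints (S.M.obj Kc) (AlgebraicClosure (w.adicCompletion F)))
    (hhecke : HeckeClause I quotΩ translΩ)
    (hunit : (UnitaryGroup.isUnit_placeForm Jstar hJu w).unit ∈ glInt 2 (w.adicCompletion F))
    (hKc : UnitaryGroup.IsHyperspecialAt ↥(maximalRealSubfield F) F (IsCMField.complexConj F) 2 Jstar Kc.1.1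
      (w.under (𝓞 ↥(maximalRealSubfield F))))
    (hroof : RoofLink I quotΩ) (hroof₂ : RoofLink₂ I translΩ)
    (hunr : ¬ (w.asIdeal ^ 2 ∣ Ideal.span {((I.pChar : ℕ) : 𝓞 F)}))
    (y : AlgPoints (S.M.obj Kc) (AlgebraicClosure (w.adicCompletion F))) (L : LineOf I y)
    (K : Subgroup ((fibreΩOf S Kc 𝓜 w e I.univ y).Points (AlgebraicClosure (w.adicCompletion F))))
    (hK : (∀ P, P ∈ L.1 ↔ P ∈ K ∧ IsIdealTorsionΩ S Kc 𝓜 w e I.univ I.act y ((IsCMField.complexConj F) • w).asIdeal P) ∧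
      RoofΩ S Kc 𝓜 w e I.univ I.act I.dual I.pol I.lvl I.pChar w.asIdeal y (quotΩ y L) K) :
    ∀ P ∈ K, IsIdealTorsionΩ S Kc 𝓜 w e I.univ I.act y (w.asIdeal * ((IsCMField.complexConj F) • w).asIdeal) P := by
  obtain ⟨σ⟩ := Literature.FieldTheory.AlgClosed.nonempty_ringHom_algebraicClosure_adicCompletion_complex F w
  have hdeg := natCard_roofKernel_eq_natCard_idealTorsionΩ I quotΩ translΩ hhecke hunit hKc hroof hroof₂ y L K hK
  obtain ⟨B, DB, lamB, hlamB, hDB, q, hq, c, hc, h1, h2, h2s, h3, h3'', h4, -⟩ := hK.2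
  haveI := hlamB; haveI := hq; haveI := hc
  have hA'' : (schΩOf S Kc 𝓜 w e I.univ (quotΩ y L)).IsOfRelDim (Module.finrank ℚ F) := I.hg ▸ isOfRelDim_schΩOf I (quotΩ y L)
  exact isIdealTorsion_mul_of_roof (actΩROf I y) (actΩROf I (quotΩ y L))
    (dualΩOf S Kc 𝓜 w e I.univ I.dual y) (polΩOf S Kc 𝓜 w e I.univ I.pol y)
    (dualΩOf S Kc 𝓜 w e I.univ I.dual (quotΩ y L)) (polΩOf S Kc 𝓜 w e I.univ I.pol (quotΩ y L)) DB lamB q c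
    w hw I.hpChar.1 I.hpChar.2 hunr (not_sq_conj_dvd_span_of_not_sq_dvd_span w I.pChar hunr) σ hA'' hDB K h1 h2 h2s h3 h3'' h4
    (fun b b' hbb' => rosatiΩ I (quotΩ y L) b b' hbb') (polQuasiInvΩ I y) hdeg

set_option maxHeartbeats 400000 in
/-- **`K[𝔭_{c•w}^∞] = L`** in datum currency: a point of the roof kernel `K` killed by some power `𝔭_{c•w}^n` lies on the line `L` (★ (ρ2″) ED. 2
`mem_of_forall_mem_pow_of_roof`, binders discharged as in `isIdealTorsionΩ_mul_of_roofLink`). [cite: Liu2021, Prop. D.8 (pp. 135–138)] [cite: Shimura1998, §13.1 Thm. 1 (pp. 97–99)] -/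
theorem mem_line_of_forall_pow_of_roofLink (I : RGDInputsAt F ι₁ Jstar K₀ S hU7ₛ hJ hJu Fi Kc G 𝓜 w hw h𝓨 θ e)
    (quotΩ : ∀ y, LineOf I y → AlgPoints (S.M.obj Kc) (AlgebraicClosure (w.adicCompletion F)))
    (translΩ : AlgPoints (S.M.obj Kc) (AlgebraicClosure (w.adicCompletion F)) → AlgPoints (S.M.obj Kc) (AlgebraicClosure (w.adicCompletion F)))
    (hhecke : HeckeClause I quotΩ translΩ)
    (hunit : (UnitaryGroup.isUnit_placeForm Jstar hJu w).unit ∈ glInt 2 (w.adicCompletion F))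
    (hKc : UnitaryGroup.IsHyperspecialAt ↥(maximalRealSubfield F) F (IsCMField.complexConj F) 2 Jstar Kc.1.1
      (w.under (𝓞 ↥(maximalRealSubfield F))))
    (hroof : RoofLink I quotΩ) (hroof₂ : RoofLink₂ I translΩ)
    (hunr : ¬ (w.asIdeal ^ 2 ∣ Ideal.span {((I.pChar : ℕ) : 𝓞 F)}))
    (y : AlgPoints (S.M.obj Kc) (AlgebraicClosure (w.adicCompletion F))) (L : LineOf I y)
    (K : Subgroup ((fibreΩOf S Kc 𝓜 w e I.univ y).Points (AlgebraicClosure (w.adicCompletion F))))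
    (hK : (∀ P, P ∈ L.1 ↔ P ∈ K ∧ IsIdealTorsionΩ S Kc 𝓜 w e I.univ I.act y ((IsCMField.complexConj F) • w).asIdeal P) ∧
      RoofΩ S Kc 𝓜 w e I.univ I.act I.dual I.pol I.lvl I.pChar w.asIdeal y (quotΩ y L) K) (n : ℕ) :
    ∀ P ∈ K, IsIdealTorsionΩ S Kc 𝓜 w e I.univ I.act y (((IsCMField.complexConj F) • w).asIdeal ^ n) P → P ∈ L.1 := by
  obtain ⟨σ⟩ := Literature.FieldTheory.AlgClosed.nonempty_ringHom_algebraicClosure_adicCompletion_complex F w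
  have hdeg := natCard_roofKernel_eq_natCard_idealTorsionΩ I quotΩ translΩ hhecke hunit hKc hroof hroof₂ y L K hK
  obtain ⟨B, DB, lamB, hlamB, hDB, q, hq, c, hc, h1, h2, h2s, h3, h3'', h4, -⟩ := hK.2
  haveI := hlamB; haveI := hq; haveI := hc
  have hA'' : (schΩOf S Kc 𝓜 w e I.univ (quotΩ y L)).IsOfRelDim (Module.finrank ℚ F) := I.hg ▸ isOfRelDim_schΩOf I (quotΩ y L)
  exact mem_of_forall_mem_pow_of_roof (actΩROf I y) (actΩROf I (quotΩ y L))
    (dualΩOf S Kc 𝓜 w e I.univ I.dual y) (polΩOf S Kc 𝓜 w e I.univ I.pol y)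
    (dualΩOf S Kc 𝓜 w e I.univ I.dual (quotΩ y L)) (polΩOf S Kc 𝓜 w e I.univ I.pol (quotΩ y L)) DB lamB q c
    w hw I.hpChar.1 I.hpChar.2 hunr (not_sq_conj_dvd_span_of_not_sq_dvd_span w I.pChar hunr) σ hA'' hDB K h1 h2 h2s h3 h3'' h4
    (fun b b' hbb' => rosatiΩ I (quotΩ y L) b b' hbb') (polQuasiInvΩ I y) hdeg L.1 hK.1 n


/-! (★ re-home, size lint: PART 1 of 2 ends here at tree line :336; the workfile continues, in the same namespace, in `Theorems/F0P6aRoofKernelCount.lean`.) -/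

end RoofKernelCount
end Summit.HodgeConjecture.HodgeConjecture.Cruxes.HLiu418.F0P6aLineSpecialisation
end
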